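import Summits.HodgeConjecture.HodgeCM.PerL34.ArchCOrbit_1

/-! PORT of `HodgeCM/PerL34/ArchCOrbit.lean` (HodgeCMPerL run 82) — part 2: continuation of `Summits.HodgeConjecture.HodgeCM.PerL34.ArchCOrbit_1` (split at a top-level declaration boundary by port_pkg.py; scope re-opened below; declarations unchanged). -/

-- port_pkg: scope re-opened for this part (file-level context, then the namespace/section stack open at the cut)
set_option autoImplicit false
noncomputable section
namespace HodgeCM
namespace PerL34
namespace ArchC
open HodgeCM.Prior.Perl34File HodgeCM.Prior.Perl34File.Perl34
section Core
variable {H HG CG G SK SigIdx SigIdxG : Type*}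
variable [NormedAddCommGroup H] [InnerProductSpace ℂ H] [CompleteSpace H]
variable [NormedAddCommGroup HG] [InnerProductSpace ℂ HG] [CompleteSpace HG]
variable [NormedAddCommGroup CG] [NormedSpace ℂ CG]
variable [Group G] [TopologicalSpace G] [TopologicalSpace SK]
namespace ArchCCore
variable {C : IsolationCore H HG CG G SK SigIdx SigIdxG} {P : C4a.PointedCore C}
/-- **`ArchCCore → OrbitCore` (KERNEL)**: the Gårding package of the old chart PROVES `orbit_stable` — from the orbit
hypothesis at g := 1 ([NODE N21] at h = 1 and R(1) = 1 give 𝒯_{ω(1)Φ} = 𝒯_Φ), then `inf_invariance` on the smooth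
vectors, `Y_mem`, `Sm_sub`, and `Sm_dense` with the L²-continuity of v ↦ 𝒯_Ψ(v)(p) (`C4a.pointFunctional_continuous`).
So the new S4 input is implied by the old one; nothing observable changes (`toOrbitCore_eigen_iff`). -/
def toOrbitCore (K : ArchCCore C P) : OrbitCore C P where
  F := K.F
  ιX := K.ιX
  X := K.X
  Tg := K.Tg
  ιT := K.ιT
  w := K.w
  w_norm := K.w_norm
  ωT := K.ωT
  FinIdx := K.FinIdx
  ins := K.ins
  φ₀ := K.φ₀
  ins_add := K.ins_add
  ins_smul := K.ins_smul
  omg_ins := K.omg_ins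
  invariance := K.invariance
  pure_detect := K.pure_detect
  orbit_stable := fun k f p i φ horb => by
    -- at g := 1: 𝒯_{ω(1)(φ⊗Φ_f)}(v) = 𝒯_{φ⊗Φ_f}(v)
    have h1 : ∀ v ∈ C.hatσ i, P.evalPt p (C.TΦc (K.ins f φ) v) = 0 := fun v hv => by
      have h := horb 1 v hv
      rwa [TΦc_omg_apply K.invariance, inv_one, map_one, one_apply_eq_self] at h
    -- on smooth vectors, by the infinitesimal identity
    have hsm : ∀ u ∈ K.Sm i, P.evalPt p (C.TΦc (K.ins f (K.X k φ)) u) = 0 := fun u hu => by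
      rw [K.inf_invariance f p k φ i u hu, h1 _ (K.Sm_sub i (K.Y_mem k i u hu)), neg_zero]
    -- pass to σ̂_i by density and continuity in v
    have hcont : Continuous fun u : H => P.evalPt p (C.TΦc (K.ins f (K.X k φ)) u) :=
      C4a.pointFunctional_continuous C P _ p
    have hsub : closure (K.Sm i) ⊆ {u : H | P.evalPt p (C.TΦc (K.ins f (K.X k φ)) u) = 0} :=
      closure_minimal hsm (isClosed_eq hcont continuous_const)
    exact fun v hv => hsub (K.Sm_dense i hv)
  gen := K.gen
  φ₀_eigen := K.φ₀_eigen

/-- Read-back: the eigenvector predicate is unchanged. -/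
theorem toOrbitCore_eigen_iff (K : ArchCCore C P) (i : SigIdx) : K.toOrbitCore.Eigen i ↔ K.Eigen i := Iff.rfl

/-- Read-backs: Fock layer, distinguished vector and character are unchanged. -/
theorem toOrbitCore_F (K : ArchCCore C P) : K.toOrbitCore.F = K.F ∧ K.toOrbitCore.φ₀ = K.φ₀ ∧
    K.toOrbitCore.w = K.w := ⟨rfl, rfl, rfl⟩

end ArchCCore

section Reduction

variable {C : IsolationCore H HG CG G SK SigIdx SigIdxG} {D : TorusData C} {P : C4a.PointedCore C}

/-- The old D-free chart yields the new one. -/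
theorem nonempty_orbitCore_of_archCCore (h : Nonempty (ArchCCore C P)) : Nonempty (OrbitCore C P) :=
  h.map ArchCCore.toOrbitCore

/-- pv06's full datum yields the new chart (forget `wOccurs_of_eigenvector`, then `ArchCCore.toOrbitCore`). -/
def ArchCDatum.toOrbitCore (A : ArchCDatum C D P) : OrbitCore C P := A.toCore.toOrbitCore

/-- (Ported verbatim from the HodgeCMPerL package; no docstring in the source.) -/
theorem ArchCDatum.toOrbitCore_eigen_iff (A : ArchCDatum C D P) (i : SigIdx) :
    A.toOrbitCore.Eigen i ↔ ∃ y ∈ C.hatσ i, y ≠ 0 ∧ ∀ t : A.Tg, C.R (A.ιT t) y = A.w t • y := Iff.rfl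

/-- **The S4 binder, D7-free form**: a D7-free chart whose eigen components have `wOccurs` gives the leaf; and the
old binder `Nonempty (ArchCDatum C D P)` supplies such a chart (so the new binder shape is implied by the old). -/
theorem exists_orbitCore_of_nonempty (h : Nonempty (ArchCDatum C D P)) :
    ∃ O : OrbitCore C P, ∀ i, O.Eigen i → D.wOccurs i :=
  h.elim fun A => ⟨A.toOrbitCore, A.wOccurs_of_eigenvector⟩

/-- (Ported verbatim from the HodgeCMPerL package; no docstring in the source.) -/
theorem occLeaf_of_exists_orbitCore (h : ∃ O : OrbitCore C P, ∀ i, O.Eigen i → D.wOccurs i) : OccLeaf C D := by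
  obtain ⟨O, hO⟩ := h
  exact O.occLeaf D hO

end Reduction

/-! ### `orbit_stable` from the Fock-side derivative alone -/

section RealDirections

variable {C : IsolationCore H HG CG G SK SigIdx SigIdxG} {P : C4a.PointedCore C}

/-- **`orbit_stable` DISCHARGED for a family of curves** — for each direction j a curve `e j : ℝ → U(W)(𝔸)` (intended
exp(sX_j); NOT even `e j 0 = 1` is used) along which [SETUP D5] `hF` holds: s ↦ 𝒯_{ω(e_j s)(φ⊗Φ_f)}(·)(p) has
derivative 𝒯_{(X_jφ)⊗Φ_f}(·)(p) at 0.  KERNEL: `vanish_of_hasDerivAt_orbit`. -/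
theorem orbit_stable_of_hasDerivAt {F FinIdx ιR : Type*} (ins : FinIdx → F → SK) (XR : ιR → F → F)
    (e : ιR → ℝ → G)
    (hF : ∀ (j : ιR) (f : FinIdx) (φ : F) (p : P.Pt),
      HasDerivAt (fun s : ℝ => C4a.pointFunctional C P (C.omg (e j s) (ins f φ)) p)
        (C4a.pointFunctional C P (ins f (XR j φ)) p) 0) :
    ∀ (j : ιR) (f : FinIdx) (p : P.Pt) (i : SigIdx) (φ : F),
      (∀ g : G, ∀ v ∈ C.hatσ i, P.evalPt p (C.TΦc (C.omg g (ins f φ)) v) = 0) →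
        ∀ v ∈ C.hatσ i, P.evalPt p (C.TΦc (ins f (XR j φ)) v) = 0 :=
  fun j f p _ φ horb => vanish_of_hasDerivAt_orbit (e j) (hF j f φ p) fun s => horb (e j s)

/-- [SETUP D4] the restricted pairing φ ↦ (v ↦ 𝒯_{φ⊗Φ_f}(v)(p)) as a ℂ-linear map, from the bare `ins` and the
two linearity identities `ins_add` / `ins_smul` (the unbundled form of `OrbitCore.pairing`). -/
def insPairing {F FinIdx : Type*} [AddCommGroup F] [Module ℂ F] (ins : FinIdx → F → SK)
    (ins_add : ∀ (f : FinIdx) (φ ψ : F), C.TΦc (ins f (φ + ψ)) = C.TΦc (ins f φ) + C.TΦc (ins f ψ))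
    (ins_smul : ∀ (f : FinIdx) (c : ℂ) (φ : F), C.TΦc (ins f (c • φ)) = c • C.TΦc (ins f φ))
    (f : FinIdx) (p : P.Pt) : F →ₗ[ℂ] (H → ℂ) where
  toFun φ := fun v => P.evalPt p (C.TΦc (ins f φ) v)
  map_add' φ ψ := by
    funext v
    simp only [Pi.add_apply]
    rw [ins_add, _root_.add_apply, map_add]
  map_smul' c φ := by
    funext v
    simp only [Pi.smul_apply, RingHom.id_apply]
    rw [ins_smul, _root_.smul_apply, map_smul]

/-- (Ported verbatim from the HodgeCMPerL package; no docstring in the source.) -/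
@[simp] theorem insPairing_apply {F FinIdx : Type*} [AddCommGroup F] [Module ℂ F] (ins : FinIdx → F → SK)
    (ins_add : ∀ (f : FinIdx) (φ ψ : F), C.TΦc (ins f (φ + ψ)) = C.TΦc (ins f φ) + C.TΦc (ins f ψ))
    (ins_smul : ∀ (f : FinIdx) (c : ℂ) (φ : F), C.TΦc (ins f (c • φ)) = c • C.TΦc (ins f φ))
    (f : FinIdx) (p : P.Pt) (φ : F) (v : H) :
    insPairing ins ins_add ins_smul f p φ v = P.evalPt p (C.TΦc (ins f φ) v) := rfl

/-- **`orbit_stable` DISCHARGED for any family in the ℂ-span of the real directions** (the slot / ladder operators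
`X k` of the explicit local models, [SETUP D5] `ladder_span`): the annihilator of σ̂_i at (f, p) is a SUBMODULE of
𝓕^κ_∞ ([SETUP D4] `ins_add`/`ins_smul`), stable under every real direction by `orbit_stable_of_hasDerivAt` and
the orbit lemma ([NODE N21] `invariance`), hence under their span (pv12-g3 `Fock.stable_of_mem_span`). -/
theorem orbit_stable_of_realDirections
    (invariance : ∀ (h : G) (Φ : SK) (v : H), C.TΦc (C.omg h Φ) (C.R h v) = C.TΦc Φ v)
    {F FinIdx : Type*} [AddCommGroup F] [Module ℂ F] (ins : FinIdx → F → SK)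
    (ins_add : ∀ (f : FinIdx) (φ ψ : F), C.TΦc (ins f (φ + ψ)) = C.TΦc (ins f φ) + C.TΦc (ins f ψ))
    (ins_smul : ∀ (f : FinIdx) (c : ℂ) (φ : F), C.TΦc (ins f (c • φ)) = c • C.TΦc (ins f φ))
    {ιR : Type*} (XR : ιR → F →ₗ[ℂ] F) (e : ιR → ℝ → G)
    (hF : ∀ (j : ιR) (f : FinIdx) (φ : F) (p : P.Pt),
      HasDerivAt (fun s : ℝ => C4a.pointFunctional C P (C.omg (e j s) (ins f φ)) p)
        (C4a.pointFunctional C P (ins f (XR j φ)) p) 0)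
    {ιX : Type*} (X : ιX → F →ₗ[ℂ] F) (hX : ∀ k, X k ∈ Submodule.span ℂ (Set.range XR)) :
    ∀ (k : ιX) (f : FinIdx) (p : P.Pt) (i : SigIdx) (φ : F),
      (∀ g : G, ∀ v ∈ C.hatσ i, P.evalPt p (C.TΦc (C.omg g (ins f φ)) v) = 0) →
        ∀ v ∈ C.hatσ i, P.evalPt p (C.TΦc (ins f (X k φ)) v) = 0 := by
  intro k f p i φ horb
  -- the annihilator of σ̂_i at (f, p): a submodule of F …
  let N : Submodule ℂ F := annihilatorIn (insPairing ins ins_add ins_smul f p) (C.hatσ i : Set H)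
  -- … stable under every real direction (orbit lemma + derivative of the zero function)
  have hN : ∀ j, ∀ ψ ∈ N, XR j ψ ∈ N := fun j ψ hψ =>
    orbit_stable_of_hasDerivAt ins (fun j φ => XR j φ) e hF j f p i ψ
      (vanish_omg_of_vanish invariance ((mem_annihilatorIn _ _ _).mp hψ))
  -- φ ∈ N: the orbit hypothesis at g := 1
  have hφ : φ ∈ N := fun v hv => by
    have h := horb 1 v hv
    rwa [TΦc_omg_apply invariance, inv_one, map_one, one_apply_eq_self] at h
  exact Fock.stable_of_mem_span XR N hN (hX k) φ hφ

end RealDirections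

end Core

/-! ## §4  The D7-free bridge records (Fock side discharged by pv12; analytic side = `hF` alone) -/

section Bridge

open HodgeCM.PerL34.Fock HodgeCM.PerL34.Fock.PrintDict

variable {H HG CG G SK SigIdx SigIdxG : Type*}
variable [NormedAddCommGroup H] [InnerProductSpace ℂ H] [CompleteSpace H]
variable [NormedAddCommGroup HG] [InnerProductSpace ℂ HG] [CompleteSpace HG]
variable [NormedAddCommGroup CG] [NormedSpace ℂ CG]
variable [Group G] [TopologicalSpace G] [TopologicalSpace SK]

/-- **Seam S4 bridge, D7-free** = pv12-g3/g4's `FockAnalyticBridge C D P` (ArchCFockAnalytic.lean) MINUS the seven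
fields `he`, `Sm`, `Sm_sub`, `Sm_dense`, `YR`, `YR_mem`, `hH`; every remaining field verbatim (name, type, order,
label — see the module docstring of ArchCFockAnalytic.lean for the print locators).  The only ANALYTIC input left is
[SETUP D5] `hF` (Fock pure tensors are smooth vectors of ω along the curves `e j`, read through Φ ↦ 𝒯_Φ(·)(p)). -/
structure FockOrbitBridge (C : IsolationCore H HG CG G SK SigIdx SigIdxG) (D : TorusData C)
    (P : C4a.PointedCore C) where
  /-- [SETUP D5 + NODE N28 local (kernel)] the real places with their κ_b-parts. -/
  pl : Fock.FockPlaces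
  /-- [SETUP D4] T(L₀⊗ℝ) ⊂ U(W)(𝔸) = `G`. -/
  ιT : pl.Tg →* G
  /-- [SETUP D4] the archimedean type w as a character of T(L₀⊗ℝ). -/
  w : pl.Tg →* ℂ
  /-- [SETUP D4] w is unitary. -/
  w_norm : ∀ t, ‖w t‖ = 1
  /-- [NODE N26 / DICTIONARY] the joint vacuum character IS w⁻¹ (verbatim `FockAnalyticBridge.w_loc`). -/
  w_loc : ∀ t : pl.Tg, pl.χ t = (w t)⁻¹
  /-- [SETUP D4] the additive group structure of 𝒮^κ. -/
  [instSKacg : AddCommGroup SK]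
  /-- [SETUP D4] the ℂ-vector-space structure of 𝒮^κ. -/
  [instSKmod : Module ℂ SK]
  /-- [SETUP D4] Φ ↦ 𝒯_Φ is additive. -/
  TΦc_add : ∀ Φ Ψ : SK, C.TΦc (Φ + Ψ) = C.TΦc Φ + C.TΦc Ψ
  /-- [SETUP D4] Φ ↦ 𝒯_Φ is homogeneous. -/
  TΦc_smul : ∀ (c : ℂ) (Φ : SK), C.TΦc (c • Φ) = c • C.TΦc Φ
  /-- [SETUP D4] Φ ↦ 𝒯_Φ(v)(g) is continuous on 𝒮^κ. -/
  cont : ∀ (p : P.Pt) (v : H), Continuous fun Φ : SK => P.evalPt p (C.TΦc Φ v)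
  /-- [SETUP D4] index of the fixed finite data Φ_f. -/
  FinIdx : Type
  /-- [SETUP D4] φ ↦ φ ⊗ Φ_f, linear. -/
  ins : FinIdx → pl.F →ₗ[ℂ] SK
  /-- [SETUP D4/D5] the pure tensors span a dense subspace of 𝒮^κ (Schwartz topology). -/
  dense : Dense (Submodule.span ℂ (Set.range fun q : FinIdx × pl.F => ins q.1 q.2) : Set SK)
  /-- [SETUP D4] ω(t)(φ ⊗ Φ_f) = (ω_∞(t)φ) ⊗ Φ_f. -/
  omg_ins : ∀ (f : FinIdx) (t : pl.Tg) (φ : pl.F), C.omg (ιT t) (ins f φ) = ins f (pl.ωT t φ)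
  /-- [NODE N21] 𝒯_{ω(h)Φ}(R(h)v) = 𝒯_Φ(v). -/
  invariance : ∀ (h : G) (Φ : SK) (v : H), C.TΦc (C.omg h Φ) (C.R h v) = C.TΦc Φ v
  /-- [SETUP D5] index of a family of real directions X_j ∈ 𝔲(W)(L₀⊗ℝ). -/
  ιR : Type
  /-- [SETUP D5] ω_∞(X_j) on 𝓕^κ_∞. -/
  XR : ιR → pl.F →ₗ[ℂ] pl.F
  /-- [SETUP D4] a curve e_j : ℝ → U(W)(𝔸) (intended exp(sX_j); only the derivative `hF` at s = 0 is consumed —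
  not even e_j(0) = 1). -/
  e : ιR → ℝ → G
  /-- [SETUP D5] every slot / ladder operator is a complex combination of the real directions. -/
  ladder_span : ∀ k : pl.ιX, pl.X k ∈ Submodule.span ℂ (Set.range XR)
  /-- [SETUP D5] s ↦ 𝒯_{ω(e_j s)(φ⊗Φ_f)}(·)(g) has derivative 𝒯_{(X_jφ)⊗Φ_f}(·)(g) at s = 0 (Fock vectors are
  Fréchet-smooth vectors of ω_∞ composed with the bounded linear Φ ↦ 𝒯_Φ(·)(g): Poulsen 1972 Prop. 1.2 + Thm. 1.2 p. 93
  + the Schwartz-topology identification: (D_∞(μ|Mp), Goodman) = (𝒮, Schwartz) by Folland 1989 p. 165 ((4.47), dμ(𝒥) = πi(D²+X²)) + Reed–Simon I App. to V.3 Lemmas 1–2 / Thm. V.13 (pp. 141–143) + Folland Thm. (4.45), locator NAMED by referee adv2-g35 O14-R (GAPS l. 9152), independently GAPS pv12g8-1; Folland 1989 Thm. (4.45) / Prop. (4.49) only for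
  the VALUE of dω(X_j) and L²-smoothness; statement verbatim `FockAnalyticBridge.hF`). -/
  hF : ∀ (j : ιR) (f : FinIdx) (φ : pl.F) (p : P.Pt),
    HasDerivAt (fun s : ℝ => C4a.pointFunctional C P (C.omg (e j s) (ins f φ)) p)
      (C4a.pointFunctional C P (ins f (XR j φ)) p) 0
  /-- [DEFINITIONAL] the meaning of the bare frozen predicate `TorusData.wOccurs` (ll. 387–390). -/
  wOccurs_of_eigenvector : ∀ i : SigIdx,
    (∃ y ∈ C.hatσ i, y ≠ 0 ∧ ∀ t : pl.Tg, C.R (ιT t) y = w t • y) → D.wOccurs i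

namespace FockOrbitBridge

variable {C : IsolationCore H HG CG G SK SigIdx SigIdxG} {D : TorusData C} {P : C4a.PointedCore C}

/-- **The D7-free chart from the D7-free bridge**, every inference field PROVED: `pure_detect` (pv05-g2
`pure_detect_of_dense`), `orbit_stable` (§3 `orbit_stable_of_hasDerivAt` — the family is indexed by the real
directions, ιX := ιR, X := XR), `gen` (pv12 `FockPlaces.gen_format_of_mem_span` via `ladder_span`), `φ₀_eigen`
(pv12 `FockPlaces.ωT_φ₀` + `w_loc`). -/
def toOrbitCore (B : FockOrbitBridge C D P) : OrbitCore C P :=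
  letI : AddCommGroup SK := B.instSKacg
  letI : Module ℂ SK := B.instSKmod
  { F := B.pl.F
    ιX := B.ιR
    X := B.XR
    Tg := B.pl.Tg
    ιT := B.ιT
    w := B.w
    w_norm := B.w_norm
    ωT := B.pl.ωT
    FinIdx := B.FinIdx
    ins := fun f φ => B.ins f φ
    φ₀ := B.pl.φ₀
    ins_add := fun f φ ψ => by
      show C.TΦc (B.ins f (φ + ψ)) = C.TΦc (B.ins f φ) + C.TΦc (B.ins f ψ)
      rw [map_add, B.TΦc_add]
    ins_smul := fun f c φ => by
      show C.TΦc (B.ins f (c • φ)) = c • C.TΦc (B.ins f φ)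
      rw [LinearMap.map_smul, B.TΦc_smul]
    omg_ins := B.omg_ins
    invariance := B.invariance
    pure_detect := pure_detect_of_dense B.TΦc_add B.TΦc_smul B.cont (fun f φ => B.ins f φ) B.dense
    orbit_stable := orbit_stable_of_hasDerivAt (fun f φ => B.ins f φ) (fun j φ => B.XR j φ) B.e B.hF
    gen := B.pl.gen_format_of_mem_span B.XR B.ladder_span
    φ₀_eigen := fun t => by rw [B.pl.ωT_φ₀, B.w_loc] }

/-- Read-backs (`rfl`): Fock layer, distinguished vector, directions, character. -/
theorem toOrbitCore_F (B : FockOrbitBridge C D P) : B.toOrbitCore.F = B.pl.F := rfl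

/-- (Ported verbatim from the HodgeCMPerL package; no docstring in the source.) -/
theorem toOrbitCore_φ₀ (B : FockOrbitBridge C D P) : B.toOrbitCore.φ₀ = B.pl.φ₀ := rfl

/-- (Ported verbatim from the HodgeCMPerL package; no docstring in the source.) -/
theorem toOrbitCore_ιX (B : FockOrbitBridge C D P) : B.toOrbitCore.ιX = B.ιR := rfl

/-- (Ported verbatim from the HodgeCMPerL package; no docstring in the source.) -/
theorem toOrbitCore_w (B : FockOrbitBridge C D P) : B.toOrbitCore.w = B.w := rfl

/-- (Ported verbatim from the HodgeCMPerL package; no docstring in the source.) -/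
theorem toOrbitCore_eigen_iff (B : FockOrbitBridge C D P) (i : SigIdx) :
    B.toOrbitCore.Eigen i ↔ ∃ y ∈ C.hatσ i, y ≠ 0 ∧ ∀ t : B.pl.Tg, C.R (B.ιT t) y = B.w t • y := Iff.rfl

/-- **Lemma 4.1(c) over the D7-free bridge** (the conclusion of pv06 `ArchCDatum.H_occ` / pv12 `FockAnalyticBridge.H_occ`,
verbatim), with NO Gårding input. -/
theorem H_occ (B : FockOrbitBridge C D P) :
    ∀ (Φ : SK) (i : SigIdx), (∃ v ∈ C.hatσ i, C.TΦ Φ v ≠ 0) → D.wOccurs i :=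
  B.toOrbitCore.occLeaf D B.wOccurs_of_eigenvector

end FockOrbitBridge

/-- **Old bridge ⇒ new bridge** (forget the seven Gårding-side fields): the D7-free input is implied by pv12's.
(Named under THIS file's record, not in pv12's `FockAnalyticBridge.*` dot-namespace, by request.) -/
def FockOrbitBridge.ofAnalytic {C : IsolationCore H HG CG G SK SigIdx SigIdxG} {D : TorusData C}
    {P : C4a.PointedCore C} (B : FockAnalyticBridge C D P) : FockOrbitBridge C D P where
  pl := B.pl
  ιT := B.ιT
  w := B.w
  w_norm := B.w_norm
  w_loc := B.w_loc
  instSKacg := B.instSKacg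
  instSKmod := B.instSKmod
  TΦc_add := B.TΦc_add
  TΦc_smul := B.TΦc_smul
  cont := B.cont
  FinIdx := B.FinIdx
  ins := B.ins
  dense := B.dense
  omg_ins := B.omg_ins
  invariance := B.invariance
  ιR := B.ιR
  XR := B.XR
  e := B.e
  ladder_span := B.ladder_span
  hF := B.hF
  wOccurs_of_eigenvector := B.wOccurs_of_eigenvector

/-- (Ported verbatim from the HodgeCMPerL package; no docstring in the source.) -/
theorem FockOrbitBridge.ofAnalytic_pl {C : IsolationCore H HG CG G SK SigIdx SigIdxG} {D : TorusData C}
    {P : C4a.PointedCore C} (B : FockAnalyticBridge C D P) :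
    (FockOrbitBridge.ofAnalytic B).pl = B.pl ∧ (FockOrbitBridge.ofAnalytic B).w = B.w := ⟨rfl, rfl⟩

/-- The composite old bridge ⇒ new bridge ⇒ `H_occ` is the old conclusion verbatim. -/
theorem FockOrbitBridge.H_occ_ofAnalytic {C : IsolationCore H HG CG G SK SigIdx SigIdxG} {D : TorusData C}
    {P : C4a.PointedCore C} (B : FockAnalyticBridge C D P) :
    ∀ (Φ : SK) (i : SigIdx), (∃ v ∈ C.hatσ i, C.TΦ Φ v ≠ 0) → D.wOccurs i :=
  (FockOrbitBridge.ofAnalytic B).H_occ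

/-- **The S4 input over the PRINTED places, D7-free** = pv12-g7's `PrintedAnalyticSide C D P RP kind lam hlam vac`
(FockPrintBridge.lean) MINUS the same seven fields; every remaining field verbatim. -/
structure PrintedOrbitSide (C : IsolationCore H HG CG G SK SigIdx SigIdxG) (D : TorusData C)
    (P : C4a.PointedCore C) (RP : Type) [Fintype RP] [DecidableEq RP] (kind : RP → PlaceKind)
    (lam : RP → ℂ) (hlam : ∀ b, lam b ≠ 0) (vac : RP → (Circle × Circle →* Circle)) where
  /-- [SETUP D4] T(L₀⊗ℝ) = ∏_b T_b ⊂ U(W)(𝔸) = `G`. -/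
  ιT : (printPlaces RP kind lam hlam vac).Tg →* G
  /-- [SETUP D4] the additive group structure of 𝒮^κ. -/
  [instSKacg : AddCommGroup SK]
  /-- [SETUP D4] the ℂ-vector-space structure of 𝒮^κ. -/
  [instSKmod : Module ℂ SK]
  /-- [SETUP D4] Φ ↦ 𝒯_Φ is additive. -/
  TΦc_add : ∀ Φ Ψ : SK, C.TΦc (Φ + Ψ) = C.TΦc Φ + C.TΦc Ψ
  /-- [SETUP D4] Φ ↦ 𝒯_Φ is homogeneous. -/
  TΦc_smul : ∀ (c : ℂ) (Φ : SK), C.TΦc (c • Φ) = c • C.TΦc Φ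
  /-- [SETUP D4] Φ ↦ 𝒯_Φ(v)(g) is continuous on 𝒮^κ. -/
  cont : ∀ (p : P.Pt) (v : H), Continuous fun Φ : SK => P.evalPt p (C.TΦc Φ v)
  /-- [SETUP D4] index of the fixed finite data Φ_f. -/
  FinIdx : Type
  /-- [SETUP D4] φ ↦ φ ⊗ Φ_f, linear. -/
  ins : FinIdx → (printPlaces RP kind lam hlam vac).F →ₗ[ℂ] SK
  /-- [SETUP D4/D5] the pure tensors span a dense subspace of 𝒮^κ. -/
  dense : Dense (Submodule.span ℂ
    (Set.range fun q : FinIdx × (printPlaces RP kind lam hlam vac).F => ins q.1 q.2) : Set SK)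
  /-- [SETUP D4] ω(t)(φ ⊗ Φ_f) = (ω_∞(t)φ) ⊗ Φ_f. -/
  omg_ins : ∀ (f : FinIdx) (t : (printPlaces RP kind lam hlam vac).Tg) (φ : (printPlaces RP kind lam hlam vac).F),
    C.omg (ιT t) (ins f φ) = ins f ((printPlaces RP kind lam hlam vac).ωT t φ)
  /-- [NODE N21] 𝒯_{ω(h)Φ}(R(h)v) = 𝒯_Φ(v). -/
  invariance : ∀ (h : G) (Φ : SK) (v : H), C.TΦc (C.omg h Φ) (C.R h v) = C.TΦc Φ v
  /-- [SETUP D5] index of a family of real directions. -/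
  ιR : Type
  /-- [SETUP D5] ω_∞(X_j) on 𝓕^κ_∞. -/
  XR : ιR → (printPlaces RP kind lam hlam vac).F →ₗ[ℂ] (printPlaces RP kind lam hlam vac).F
  /-- [SETUP D4] the curves e_j (intended exp(sX_j)). -/
  e : ιR → ℝ → G
  /-- [SETUP D5] ladder operators are complex combinations of the real directions. -/
  ladder_span : ∀ k : (printPlaces RP kind lam hlam vac).ιX,
    (printPlaces RP kind lam hlam vac).X k ∈ Submodule.span ℂ (Set.range XR)
  /-- [SETUP D5] the Fock-side derivative (verbatim `PrintedAnalyticSide.hF`). -/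
  hF : ∀ (j : ιR) (f : FinIdx) (φ : (printPlaces RP kind lam hlam vac).F) (p : P.Pt),
    HasDerivAt (fun s : ℝ => C4a.pointFunctional C P (C.omg (e j s) (ins f φ)) p)
      (C4a.pointFunctional C P (ins f (XR j φ)) p) 0
  /-- [DEFINITIONAL] meaning of `TorusData.wOccurs`, with the printed `w`. -/
  wOccurs_of_eigenvector : ∀ i : SigIdx,
    (∃ y ∈ C.hatσ i, y ≠ 0 ∧ ∀ t : (printPlaces RP kind lam hlam vac).Tg,
      C.R (ιT t) y = printPlacesW RP kind lam hlam vac t • y) → D.wOccurs i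

namespace PrintedOrbitSide

variable {C : IsolationCore H HG CG G SK SigIdx SigIdxG} {D : TorusData C} {P : C4a.PointedCore C}
variable {RP : Type} [Fintype RP] [DecidableEq RP] {kind : RP → PlaceKind} {lam : RP → ℂ} {hlam : ∀ b, lam b ≠ 0}
  {vac : RP → (Circle × Circle →* Circle)}


-- port_pkg: scope closed for this part
end PrintedOrbitSide
end Bridge
end ArchC
end PerL34
end HodgeCM
end
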